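import Summits.CriticalPhenomena.PercolationContinuityZ3.Theorems.PercNearOneGluingNoHeavyRsw3AnnulusTwoArmFarSeparation
import HarnessLib

/-!
# RSW3 lane (P2, gen 14): THE FAR SPONGE DICHOTOMY — two clusters crossing `Λ(M) ∖ Λ(n)` distinct inside `Λ(L)`, OR a near-certain thin-way
# crossing of the WIDE middle block `{0..2n} × {0..2L}²`; positivity at every scale (every `p`)

builds on p205010 (kernel theorem, internal audit signed; external expert review pending)

Cell `prim-rsw3`, prover seat `prim-rsw3-p2` (gen 14), memo `run/shared/lean/prim/rsw3/P2-RSWLITE.md` §21.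
Support file (`--supports stmt-CriticalPhenomena-4575`); no definitions, no named facts, no sorries.

With the far two-arm event `far(n, M, L) = {∃ x y ∈ Λ(n), x ↔ ∂ⁱⁿΛ(M) in Λ(M), y ↔ ∂ⁱⁿΛ(M) in Λ(M), x ↮ y in Λ(L)}` (written inline) and the localised
radial probability `σ_loc(n,M) = P_p({n}×[-n,n]² ↔ {x₀ = M} in [n,M]×[-M,M]²)` of gen 13:

* `real_loc_sq_mul_real_compl_boxCross_le_real_far` (every `p`, `1 ≤ n < M ≤ L`):  `σ_loc(n,M)² · P_p((boxCross (2n, 2L, 2L) 0)ᶜ) ≤ P_p(far(n,M,L))`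
  — the WIDE middle layer `[-n,n] × [-L,L]²` of the LARGER ball `Λ(L)`, sealed for the paths using an edge with an endpoint strictly between the planes
  `{x₀ = ±n}`, is an admissible wall for `real_mul_real_mul_le_real_far`; so a SMALL far two-arm probability at `(n, M, L)` forces near-certain
  thin-way crossings of the blocks `(2n; 2L, 2L)` — plates of length `2n` in windows of width `2L`, exactly what the far renormalisation
  (`…Rsw3AnnulusTwoArmFarCells`, zone radii `(n, M) = (N, 3N)`, separation radius `L`) consumes;
* `real_loc_sq_mul_one_sub_pow_le_real_far` — positivity `σ_loc(n,M)² (1-p)^{(2L+1)⁶} ≤ P_p(far(n,M,L))` for the small scales.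
Gen 13's `…SpongeDichotomyAspect` / `…CriticalCriterionAspect` are the case `L = M`.

References: M. Aizenman, Nucl. Phys. B 485 (1997) 551–582, §2 Remark 2 [Aizenman1997]; H. Kesten, *Percolation Theory for Mathematicians* (1982),
§3.3 [Kesten1982]; G. Grimmett, *Percolation* (1999), §7.2, §11.7 [GrimmettPercolation1999]. [folklore]
-/

noncomputable section

namespace Summit.CriticalPhenomena.PercolationContinuityZ3.Theorems

namespace Rsw3

open MeasureTheory Literature.Probability.LatticeModels Literature.Probability.Percolation
open Literature.Probability.Percolation.KozmaNitzan SurfaceTension Crossing SimpleGraph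

/-! ## The far sponge dichotomy: the WIDE middle block `[-n,n] × [-L,L]²` -/

/-- **`σ₊^loc(n,M) · σ₋^loc(n,M) · P_p((boxCross (2n, 2L, 2L) 0)ᶜ) ≤ P_p(far(n, M, L))` for every `p`, `1 ≤ n < M ≤ L`.**  Two localised radial
crossings of `Λ(M) ∖ Λ(n)` and the WIDE middle layer `[-n,n] × [-L,L]²` of the larger ball `Λ(L)` (a translate of `{0..2n} × {0..2L}²`) sealed for the
paths using only edges with an endpoint strictly between the planes `{x₀ = ±n}` — an admissible wall for `real_mul_real_mul_le_real_far`, containing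
the plain seal.  Gen 13's `real_mul_real_mul_real_compl_boxCross_le_annulusTwoArmProb` is the case `L = M`. [folklore] -/
theorem real_mul_real_mul_real_compl_boxCross_le_real_far (p : unitInterval) {n M L : ℕ} (hn : 1 ≤ n) (hnM : n + 1 ≤ M)
    (hML : M ≤ L) :
    (bondPercolation (zdGraph 3) p).real
        (linked (Set.Icc ![(n : ℤ), -(M : ℤ), -(M : ℤ)] ![(M : ℤ), (M : ℤ), (M : ℤ)])
          (Set.Icc ![(n : ℤ), -(n : ℤ), -(n : ℤ)] ![(n : ℤ), (n : ℤ), (n : ℤ)])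
          (Set.Icc ![(M : ℤ), -(M : ℤ), -(M : ℤ)] ![(M : ℤ), (M : ℤ), (M : ℤ)])) *
      (bondPercolation (zdGraph 3) p).real
        (linked (Set.Icc ![-(M : ℤ), -(M : ℤ), -(M : ℤ)] ![-(n : ℤ), (M : ℤ), (M : ℤ)])
          (Set.Icc ![-(n : ℤ), -(n : ℤ), -(n : ℤ)] ![-(n : ℤ), (n : ℤ), (n : ℤ)])
          (Set.Icc ![-(M : ℤ), -(M : ℤ), -(M : ℤ)] ![-(M : ℤ), (M : ℤ), (M : ℤ)])) *
        (bondPercolation (zdGraph 3) p).real (boxCross ![2 * (n : ℤ), 2 * (L : ℤ), 2 * (L : ℤ)] 0)ᶜ ≤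
      (bondPercolation (zdGraph 3) p).real
        {ω : BondConfig (Site 3) | ∃ x ∈ box 3 n, ∃ y ∈ box 3 n, ω ∈ toBdry M x ∧ ω ∈ toBdry M y ∧
          ω ∉ openConnIn (↑(box 3 L) : Set (Site 3)) x y} := by
  classical
  -- the proof of `real_mul_real_mul_real_compl_boxCross_le_annulusTwoArmProb` (gen 13) verbatim, with the layer of `Λ(L)` and arms to `M`
  set μ := bondPercolation (zdGraph 3) p with hμ
  have hnL : n + 1 ≤ L := hnM.trans hML
  -- the middle layer `R = v + {0..Mv}`, `v = (-n, -L, -L)`, `Mv = (2n, 2L, 2L)`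
  set Mv : Site 3 := ![2 * (n : ℤ), 2 * (L : ℤ), 2 * (L : ℤ)] with hMv
  set v : Site 3 := ![-(n : ℤ), -(L : ℤ), -(L : ℤ)] with hv
  have hM0 : Mv 0 = 2 * (n : ℤ) := by simp [hMv]
  have hMj : ∀ j : Fin 3, j ≠ 0 → Mv j = 2 * (L : ℤ) := by
    intro j hj; fin_cases j <;> simp [hMv] at hj ⊢
  have hv0 : v 0 = -(n : ℤ) := by simp [hv]
  have hvj : ∀ j : Fin 3, j ≠ 0 → v j = -(L : ℤ) := by
    intro j hj; fin_cases j <;> simp [hv] at hj ⊢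
  set R : Set (Site 3) := {x | ∀ j, v j ≤ x j ∧ x j ≤ v j + Mv j} with hR
  set A : Set (Site 3) := {x | x ∈ R ∧ x 0 = v 0} with hA
  set B : Set (Site 3) := {x | x 0 = v 0 + Mv 0} with hB
  set X : Set (BondConfig (Site 3)) := linked R A B with hX
  -- the admissible edge class and the edge-restricted seal
  set T : Set (Sym2 (Site 3)) := {e | ∃ x ∈ e, |x 0| < (n : ℤ)} with hT
  set W : Set (BondConfig (Site 3)) := {ω | ω ∩ T ∉ X} with hW
  have hWT : DeterminedBy W T := by
    rw [determinedBy_iff]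
    intro ω ω' h
    simp only [hW, Set.mem_setOf_eq, h]
  have hmeas : Measurable fun ω : BondConfig (Site 3) => ω ∩ T :=
    measurable_set_iff.2 fun e => (measurable_set_mem e).and measurable_const
  have hXm : MeasurableSet X := measurableSet_linked R A B
  have hWm : MeasurableSet W := by
    have : W = (fun ω : BondConfig (Site 3) => ω ∩ T) ⁻¹' Xᶜ := rfl
    rw [this]
    exact hXm.compl.preimage hmeas
  have hTn : ∀ e ∈ T, ∃ x ∈ e, |x 0| < (n : ℤ) := fun e he => he
  -- membership in `R` from the coordinate bounds
  have hmemR : ∀ x : Site 3, -(n : ℤ) ≤ x 0 → x 0 ≤ n → x ∈ box 3 L → x ∈ R := by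
    intro x h1 h2 hx
    rw [mem_box] at hx
    intro j
    by_cases hj : j = 0
    · subst hj; rw [hv0, hM0]; omega
    · rw [hvj j hj, hMj j hj]; have := hx j; omega
  -- (b) the kill property inside `Λ(L)`
  have hkill : ∀ ω, ω ⊆ (zdGraph 3).edgeSet → ω ∈ W → ∀ a b : Site 3, a 0 = -(n : ℤ) → b 0 = n →
      ¬ (openGraph ω ⊓ withinGraph (zdGraph 3) (↑(box 3 L) : Set (Site 3))).Reachable a b := by
    intro ω _ hWω a b ha hb hab
    apply hWω
    -- the walk and the graph
    set H := openGraph ω ⊓ withinGraph (zdGraph 3) (↑(box 3 L) : Set (Site 3)) with hH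
    have hHle : H ≤ zdGraph 3 := fun x y hxy => (withinGraph_adj.1 hxy.2).1
    obtain ⟨Wk⟩ := hab
    -- `s` = first index with `x₀ = n`
    have hex_s : ∃ s : ℕ, Wk.getVert s 0 = n := ⟨Wk.length, by rw [Wk.getVert_length, hb]⟩
    set s := Nat.find hex_s with hs
    have hs_eq : Wk.getVert s 0 = n := Nat.find_spec hex_s
    have hs_len : s ≤ Wk.length := Nat.find_min' hex_s (by rw [Wk.getVert_length, hb])
    have hs_ne : ∀ r, r < s → Wk.getVert r 0 ≠ n := fun r hr => Nat.find_min hex_s hr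
    have hs_lt : ∀ r, r < s → Wk.getVert r 0 < n := by
      intro r hr
      by_contra hge
      push Not at hge
      obtain ⟨j, hj, hjn⟩ := exists_getVert_apply_eq hHle Wk 0 (n : ℤ) 0 r (by omega)
        (by rw [Wk.getVert_zero, ha]; omega) (by rw [zero_add]; exact hge)
      rw [zero_add] at hjn
      exact hs_ne j (by omega) hjn
    -- `t` = last index `≤ s` with `x₀ = -n`
    set t := Nat.findGreatest (fun r => Wk.getVert r 0 = -(n : ℤ)) s with ht
    have ht_eq : Wk.getVert t 0 = -(n : ℤ) :=
      Nat.findGreatest_spec (P := fun r => Wk.getVert r 0 = -(n : ℤ)) (Nat.zero_le s)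
        (by rw [Wk.getVert_zero, ha])
    have ht_le : t ≤ s := Nat.findGreatest_le s
    have ht_lt : t < s := by
      rcases ht_le.lt_or_eq with h | h
      · exact h
      · exfalso; rw [← h, ht_eq] at hs_eq; omega
    have ht_max : ∀ r, t < r → r ≤ s → Wk.getVert r 0 ≠ -(n : ℤ) := fun r hr hrs =>
      Nat.findGreatest_is_greatest hr hrs
    have ht_gt : ∀ r, t < r → r ≤ s → -(n : ℤ) < Wk.getVert r 0 := by
      intro r hr hrs
      by_contra hge
      push Not at hge
      obtain ⟨j, hj, hjn⟩ := exists_getVert_apply_eq hHle Wk 0 (-(n : ℤ)) r (s - r) (by omega) hge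
        (by rw [Nat.add_sub_cancel' hrs, hs_eq]; omega)
      exact ht_max (r + j) (by omega) (by omega) hjn
    -- every vertex of the walk lies in `Λ(L)`
    have hmem_box : ∀ r, r ≤ Wk.length → 0 < Wk.length → Wk.getVert r ∈ box 3 L := by
      intro r hr hpos
      rcases Nat.lt_or_ge r Wk.length with hlt | hge
      · have hadj := Wk.adj_getVert_succ hlt
        exact Finset.mem_coe.1 (withinGraph_adj.1 hadj.2).2.1
      · have hr' : r = Wk.length := le_antisymm hr hge
        obtain ⟨l, hl⟩ : ∃ l, Wk.length = l + 1 := ⟨Wk.length - 1, by omega⟩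
        have hadj := Wk.adj_getVert_succ (i := l) (by omega)
        rw [← hl] at hadj
        rw [hr']
        exact Finset.mem_coe.1 (withinGraph_adj.1 hadj.2).2.2
    have hlen_pos : 0 < Wk.length := by
      by_contra h0
      push Not at h0
      have h0' : Wk.length = 0 := by omega
      have := hs_len
      rw [h0'] at this
      have hs0 : s = 0 := by omega
      rw [hs0, Wk.getVert_zero, ha] at hs_eq
      omega
    have hR_of : ∀ r, t ≤ r → r ≤ s → Wk.getVert r ∈ R := by
      intro r htr hrs
      refine hmemR _ ?_ ?_ (hmem_box r (hrs.trans hs_len) hlen_pos)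
      · rcases htr.lt_or_eq with h | h
        · exact (ht_gt r h hrs).le
        · rw [← h, ht_eq]
      · rcases hrs.lt_or_eq with h | h
        · exact (hs_lt r h).le
        · rw [h, hs_eq]
    -- adjacency in the restricted graph along `[t, s]`
    set H' := openGraph (ω ∩ T) ⊓ withinGraph (zdGraph 3) R with hH'
    have hadj' : ∀ r, t ≤ r → r < s → H'.Adj (Wk.getVert r) (Wk.getVert (r + 1)) := by
      intro r htr hrs
      have hadj := Wk.adj_getVert_succ (i := r) (by omega)
      obtain ⟨hopen, hwithin⟩ := (SimpleGraph.inf_adj _ _ _ _).1 hadj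
      rw [withinGraph_adj] at hwithin
      obtain ⟨he, hne⟩ := (openGraph_adj ω _ _).1 hopen
      have hTmem : s(Wk.getVert r, Wk.getVert (r + 1)) ∈ T := by
        rcases htr.lt_or_eq with h | h
        · exact ⟨Wk.getVert r, Sym2.mem_mk_left _ _,
            abs_lt.2 ⟨ht_gt r h (by omega), hs_lt r hrs⟩⟩
        · have h2 : t + 1 < s := by
            by_contra hle
            push Not at hle
            have hts : s = t + 1 := by omega
            have h1 := (coord_sub_le_one_of_adj hwithin.1 0).2
            have e1 : Wk.getVert r 0 = -(n : ℤ) := by rw [← h]; exact ht_eq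
            have e2 : Wk.getVert (r + 1) 0 = n := by
              have e := hs_eq
              rw [hts, h] at e
              exact e
            have h1n : (1 : ℤ) ≤ n := by exact_mod_cast hn
            omega
          refine ⟨Wk.getVert (r + 1), Sym2.mem_mk_right _ _, abs_lt.2 ⟨?_, ?_⟩⟩
          · exact ht_gt (r + 1) (by omega) (by omega)
          · exact hs_lt (r + 1) (by omega)
      refine (SimpleGraph.inf_adj _ _ _ _).2 ⟨(openGraph_adj _ _ _).2 ⟨⟨he, hTmem⟩, hne⟩, ?_⟩
      rw [withinGraph_adj]
      exact ⟨hwithin.1, hR_of r htr (by omega), hR_of (r + 1) (by omega) (by omega)⟩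
    have hreach : ∀ k, t + k ≤ s → H'.Reachable (Wk.getVert t) (Wk.getVert (t + k)) := by
      intro k
      induction k with
      | zero => intro _; exact SimpleGraph.Reachable.refl _
      | succ k ih =>
        intro hk
        have h1 := ih (by omega)
        have h2 := (hadj' (t + k) (by omega) (by omega)).reachable
        rw [← add_assoc]
        exact h1.trans h2
    have hts : H'.Reachable (Wk.getVert t) (Wk.getVert s) := by
      have := hreach (s - t) (by omega)
      rwa [Nat.add_sub_cancel' ht_le] at this
    rw [hX, mem_linked_iff]
    refine ⟨Wk.getVert t, ⟨hR_of t le_rfl ht_le, by rw [ht_eq, hv0]⟩, Wk.getVert s,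
      by show Wk.getVert s 0 = v 0 + Mv 0; rw [hs_eq, hv0, hM0]; ring, ?_⟩
    rw [mem_inConn_iff]
    exact hts
  -- the far separation lemma with this wall
  have hmain := real_mul_real_mul_le_real_far p (L := L) hn hnM hWT hWm hTn hkill
  -- (c) `P(W) ≥ 1 - P(X) ≥ P((boxCross Mv 0)ᶜ)`
  have hXW : Xᶜ ⊆ W := by
    intro ω hω hωT
    exact hω (isUpperSet_linked R A B (Set.inter_subset_left : ω ∩ T ⊆ ω) hωT)
  have hM0' : (0 : ℤ) ≤ Mv 0 := by rw [hM0]; positivity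
  have hXle : μ.real X ≤ μ.real (boxCross Mv 0) :=
    real_linked_le_real_boxCross p (R := R) (A := A) (B := B) (v := v) (M := Mv) (L := Mv) 0
      (fun x hx => hx) (fun x hx => hx.1) (fun x hx => hx.2) (fun x hx => hx) hM0' le_rfl (fun j _ => le_rfl)
  have hXc : μ.real Xᶜ = 1 - μ.real X := probReal_compl_eq_one_sub hXm
  have hBc : μ.real (boxCross Mv 0)ᶜ = 1 - μ.real (boxCross Mv 0) :=
    probReal_compl_eq_one_sub (measurableSet_boxCross Mv 0)
  have hXW' : μ.real Xᶜ ≤ μ.real W := measureReal_mono hXW (measure_ne_top μ W)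
  have hcompl : μ.real (boxCross Mv 0)ᶜ ≤ μ.real W := by
    rw [hBc]; rw [hXc] at hXW'; linarith
  have h0 : 0 ≤ μ.real
        (linked (Set.Icc ![(n : ℤ), -(M : ℤ), -(M : ℤ)] ![(M : ℤ), (M : ℤ), (M : ℤ)])
          (Set.Icc ![(n : ℤ), -(n : ℤ), -(n : ℤ)] ![(n : ℤ), (n : ℤ), (n : ℤ)])
          (Set.Icc ![(M : ℤ), -(M : ℤ), -(M : ℤ)] ![(M : ℤ), (M : ℤ), (M : ℤ)])) *
      μ.real
        (linked (Set.Icc ![-(M : ℤ), -(M : ℤ), -(M : ℤ)] ![-(n : ℤ), (M : ℤ), (M : ℤ)])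
          (Set.Icc ![-(n : ℤ), -(n : ℤ), -(n : ℤ)] ![-(n : ℤ), (n : ℤ), (n : ℤ)])
          (Set.Icc ![-(M : ℤ), -(M : ℤ), -(M : ℤ)] ![-(M : ℤ), (M : ℤ), (M : ℤ)])) :=
    mul_nonneg measureReal_nonneg measureReal_nonneg
  exact (mul_le_mul_of_nonneg_left hcompl h0).trans hmain

/-- **THE FAR SPONGE DICHOTOMY (every `p`, `1 ≤ n < M ≤ L`):**
`σ_loc(n,M)² · P_p((boxCross (2n, 2L, 2L) 0)ᶜ) ≤ P_p(far(n, M, L))`, `σ_loc(n,M) = P_p({n}×[-n,n]² ↔ {x₀ = M} in [n,M]×[-M,M]²)` — two clusters crossing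
`Λ(M) ∖ Λ(n)` that are distinct inside `Λ(L)`, OR the wide middle block `(2n; 2L, 2L)` is crossed the thin way.  So a SMALL far two-arm probability forces
near-certain thin-way crossings of `(2n; 2L, 2L)`. [cite: Aizenman1997, §2 Remark 2] -/
theorem real_loc_sq_mul_real_compl_boxCross_le_real_far (p : unitInterval) {n M L : ℕ} (hn : 1 ≤ n) (hnM : n + 1 ≤ M) (hML : M ≤ L) :
    (bondPercolation (zdGraph 3) p).real
        (linked (Set.Icc ![(n : ℤ), -(M : ℤ), -(M : ℤ)] ![(M : ℤ), (M : ℤ), (M : ℤ)])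
          (Set.Icc ![(n : ℤ), -(n : ℤ), -(n : ℤ)] ![(n : ℤ), (n : ℤ), (n : ℤ)])
          (Set.Icc ![(M : ℤ), -(M : ℤ), -(M : ℤ)] ![(M : ℤ), (M : ℤ), (M : ℤ)])) ^ 2 *
        (bondPercolation (zdGraph 3) p).real (boxCross ![2 * (n : ℤ), 2 * (L : ℤ), 2 * (L : ℤ)] 0)ᶜ ≤
      (bondPercolation (zdGraph 3) p).real
        {ω : BondConfig (Site 3) | ∃ x ∈ box 3 n, ∃ y ∈ box 3 n, ω ∈ toBdry M x ∧ ω ∈ toBdry M y ∧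
          ω ∉ openConnIn (↑(box 3 L) : Set (Site 3)) x y} := by
  have h := real_mul_real_mul_real_compl_boxCross_le_real_far p hn hnM hML
  rw [real_linked_radialMinus_eq p n M] at h
  rw [sq]
  exact h

/-! ## Positivity at every scale -/

/-- **`σ_loc(n,M)² · (1-p)^{(2L+1)⁶} ≤ P_p(far(n, M, L))` for every `p`, `1 ≤ n < M ≤ L`** — all pairs `s(q,q')` with `q ∈ Λ(L) ∩ {x₀ = 0}`,
`q' ∈ Λ(L)` closed is an admissible wall (a plane-to-plane path inside `Λ(L)` visits `{x₀ = 0}` and steps on).  A positivity statement for the small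
scales; gen 13's `real_mul_real_mul_one_sub_pow_le_annulusTwoArmProb` is the case `L = M`. [folklore] -/
theorem real_loc_sq_mul_one_sub_pow_le_real_far (p : unitInterval) {n M L : ℕ} (hn : 1 ≤ n) (hnM : n + 1 ≤ M) (hML : M ≤ L) :
    (bondPercolation (zdGraph 3) p).real
        (linked (Set.Icc ![(n : ℤ), -(M : ℤ), -(M : ℤ)] ![(M : ℤ), (M : ℤ), (M : ℤ)])
          (Set.Icc ![(n : ℤ), -(n : ℤ), -(n : ℤ)] ![(n : ℤ), (n : ℤ), (n : ℤ)])
          (Set.Icc ![(M : ℤ), -(M : ℤ), -(M : ℤ)] ![(M : ℤ), (M : ℤ), (M : ℤ)])) ^ 2 *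
        (1 - (p : ℝ)) ^ ((2 * L + 1) ^ 6) ≤
      (bondPercolation (zdGraph 3) p).real
        {ω : BondConfig (Site 3) | ∃ x ∈ box 3 n, ∃ y ∈ box 3 n, ω ∈ toBdry M x ∧ ω ∈ toBdry M y ∧
          ω ∉ openConnIn (↑(box 3 L) : Set (Site 3)) x y} := by
  classical
  -- adapted from `real_mul_real_mul_one_sub_pow_le_annulusTwoArmProb` (gen 13): the wall lives in `Λ(L)`
  set μ := bondPercolation (zdGraph 3) p with hμ
  have hnL : n + 1 ≤ L := hnM.trans hML
  set P0 : Finset (Site 3) := (box 3 L).filter (fun x => x 0 = 0) with hP0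
  set F : Finset (Sym2 (Site 3)) := ((P0 ×ˢ box 3 L).image fun q => s(q.1, q.2)) with hF
  set W : Set (BondConfig (Site 3)) := {ω | ∀ e ∈ F, e ∉ ω} with hW
  have hWT : DeterminedBy W (↑F : Set (Sym2 (Site 3))) := determinedBy_forall_notMem F
  have hWm : MeasurableSet W := measurableSet_forall_notMem F
  have hT : ∀ e ∈ (↑F : Set (Sym2 (Site 3))), ∃ x ∈ e, |x 0| < (n : ℤ) := by
    intro e he
    rw [Finset.mem_coe, hF, Finset.mem_image] at he
    obtain ⟨q, hq, rfl⟩ := he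
    rw [Finset.mem_product, hP0, Finset.mem_filter] at hq
    refine ⟨q.1, Sym2.mem_mk_left _ _, ?_⟩
    rw [hq.1.2]; simp; exact_mod_cast hn
  have hkill : ∀ ω, ω ⊆ (zdGraph 3).edgeSet → ω ∈ W → ∀ a b : Site 3, a 0 = -(n : ℤ) → b 0 = n →
      ¬ (openGraph ω ⊓ withinGraph (zdGraph 3) (↑(box 3 L) : Set (Site 3))).Reachable a b := by
    intro ω _ hWω a b ha hb hab
    obtain ⟨q, hq0, -, hqb⟩ := exists_plane_of_reachable ha hb hab
    have hqb_ne : q ≠ b := by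
      intro h; rw [h, hb] at hq0
      have : (1 : ℤ) ≤ n := by exact_mod_cast hn
      omega
    obtain ⟨Wk⟩ := hqb
    cases Wk with
    | nil => exact hqb_ne rfl
    | @cons _ q' _ hadj _ =>
      obtain ⟨hopen, hwithin⟩ := (SimpleGraph.inf_adj _ _ _ _).1 hadj
      rw [withinGraph_adj] at hwithin
      have hmem : s(q, q') ∈ F := by
        rw [hF, Finset.mem_image]
        refine ⟨(q, q'), ?_, rfl⟩
        rw [Finset.mem_product, hP0, Finset.mem_filter]
        exact ⟨⟨Finset.mem_coe.1 hwithin.2.1, hq0⟩, Finset.mem_coe.1 hwithin.2.2⟩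
      exact hWω _ hmem ((openGraph_adj ω q q').1 hopen).1
  have hmain := real_mul_real_mul_le_real_far p (L := L) hn hnM hWT hWm hT hkill
  rw [real_linked_radialMinus_eq p n M] at hmain
  -- `P(W) ≥ (1-p)^{|F|} ≥ (1-p)^{(2L+1)^6}`
  have hcardF : F.card ≤ (2 * L + 1) ^ 6 := by
    have h1 : F.card ≤ (P0 ×ˢ box 3 L).card := Finset.card_image_le
    have h2 : (P0 ×ˢ box 3 L).card = P0.card * (box 3 L).card := Finset.card_product _ _
    have h3 : P0.card ≤ (box 3 L).card := Finset.card_filter_le _ _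
    have h4 : (box 3 L).card = (2 * L + 1) ^ 3 := card_box 3 L
    have h5 : (2 * L + 1) ^ 3 * (2 * L + 1) ^ 3 = (2 * L + 1) ^ 6 := by ring_nf
    calc F.card ≤ P0.card * (box 3 L).card := by rw [← h2]; exact h1
      _ ≤ (box 3 L).card * (box 3 L).card := Nat.mul_le_mul_right _ h3
      _ = (2 * L + 1) ^ 6 := by rw [h4, h5]
  have hp0 : 0 ≤ 1 - (p : ℝ) := by linarith [p.2.2]
  have hp1 : 1 - (p : ℝ) ≤ 1 := by linarith [p.2.1]
  have hWge : (1 - (p : ℝ)) ^ ((2 * L + 1) ^ 6) ≤ μ.real W :=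
    (pow_le_pow_of_le_one hp0 hp1 hcardF).trans (le_bondPercolation_real_forall_notMem (zdGraph 3) p F)
  have h0 : 0 ≤ μ.real
        (linked (Set.Icc ![(n : ℤ), -(M : ℤ), -(M : ℤ)] ![(M : ℤ), (M : ℤ), (M : ℤ)])
          (Set.Icc ![(n : ℤ), -(n : ℤ), -(n : ℤ)] ![(n : ℤ), (n : ℤ), (n : ℤ)])
          (Set.Icc ![(M : ℤ), -(M : ℤ), -(M : ℤ)] ![(M : ℤ), (M : ℤ), (M : ℤ)])) ^ 2 := sq_nonneg _
  rw [sq] at h0 ⊢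
  exact (mul_le_mul_of_nonneg_left hWge h0).trans hmain

end Rsw3

end Summit.CriticalPhenomena.PercolationContinuityZ3.Theorems

end
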